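import Mathlib.MeasureTheory.Measure.CharacteristicFunction.Basic
import Literature.Probability.LatticeModels.IsingLimitLawTilt
import Literature.Probability.LatticeModels.IsingLimitLawLaplace
import HarnessLib

/-!
# Scaling of weights; the two-point laws (bookends of the tower class inside `IsIsingLimitLaw`)

Trunk T-STATMECH (`Literature/Probability/LatticeModels`), companion of `IsingLimitLaw.lean`,
`IsingLimitLawConv.lean` and `IsingLimitLawGaussTilt.lean` (route RiemannHypothesis/LeeYang). With those
two files, this one shows that the product / forward-heat-flow TOWER class (closure of the symmetric
two-point laws `cosh(wz)` under products, Gaussian tilts `e^{cu²}`, `c ≥ 0`, and scaling) consists of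
Ising limit laws.

* `isingMagnetizationLaw_smul` — scaling all weights by `a` pushes the magnetization law forward by
  `u ↦ a u`.
* `IsIsingLimitLaw.scale` — the class is closed under `u ↦ a u`, `a ≥ 0` (weights `a wᵢ ≥ 0`; weak
  convergence maps forward under the continuous map; `∫ e^{bu²} d(law ∘ (a·)⁻¹) = ∫ e^{b a² u²} d law`).
* `isingMagnetizationLaw_one_eq_twoPoint` — one spin of weight `a` has the symmetric two-point law
  `½ δ_a + ½ δ_{−a}`; hence `isIsingLimitLaw_twoPoint`.

## References

* C. M. Newman, CPAM 27 (1974) 143–159, §1; Proc. AMS 61 (1976), §1.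
* B. Simon, R. B. Griffiths, CMP 33 (1973) 145–164, §II (scaled block spins).
-/

noncomputable section

open MeasureTheory Filter Topology
open scoped BigOperators ENNReal

namespace Literature.Probability.LatticeModels

variable {n : ℕ}

/-! ### Scaling the weights -/

/-- Scaling the weights scales the magnetization. [folklore] -/
theorem weightedMagnetization_smul (a : ℝ) (w : Fin n → ℝ) (s : Fin n → Bool) :
    weightedMagnetization (fun i => a * w i) s = a * weightedMagnetization w s := by
  simp only [weightedMagnetization, Finset.mul_sum, mul_assoc]

/-- **Scaling the weights pushes the magnetization law forward by `u ↦ a u`.** [folklore] -/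
theorem isingMagnetizationLaw_smul (a : ℝ) (J : Fin n → Fin n → ℝ) (w : Fin n → ℝ) :
    (isingMagnetizationLaw n J (fun i => a * w i) : Measure ℝ) =
      (isingMagnetizationLaw n J w : Measure ℝ).map (fun u => a * u) := by
  change ((isingPairPMF J).map (weightedMagnetization fun i => a * w i)).toMeasure =
    ((isingPairPMF J).map (weightedMagnetization w)).toMeasure.map (fun u => a * u)
  rw [PMF.toMeasure_map (fun u => a * u) _ (measurable_const_mul a), PMF.map_comp]
  congr 2
  funext s
  exact weightedMagnetization_smul a w s

/-- **Ising limit laws are closed under scaling `u ↦ a u`, `a ≥ 0`.** [Newman 1974, §1] [folklore] -/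
theorem IsIsingLimitLaw.scale {a : ℝ} (ha : 0 ≤ a) {ν ν' : ProbabilityMeasure ℝ}
    (hν : IsIsingLimitLaw ν) (h : (ν' : Measure ℝ) = (ν : Measure ℝ).map (fun u => a * u)) :
    IsIsingLimitLaw ν' := by
  obtain ⟨n, J, w, hJ, hw, hlim, hmom⟩ := hν
  have hcont : Continuous fun u : ℝ => a * u := continuous_const.mul continuous_id
  have hν'eq : ν' = ν.map hcont.measurable.aemeasurable := by
    apply ProbabilityMeasure.toMeasure_injective
    rw [h]; rfl
  have hk : ∀ k, isingMagnetizationLaw (n k) (J k) (fun i => a * w k i) =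
      (isingMagnetizationLaw (n k) (J k) (w k)).map hcont.measurable.aemeasurable := by
    intro k
    apply ProbabilityMeasure.toMeasure_injective
    rw [isingMagnetizationLaw_smul]; rfl
  refine ⟨n, J, fun k i => a * w k i, hJ, fun k i => mul_nonneg ha (hw k i), ?_, fun b => ?_⟩
  · -- weak convergence of the push-forwards
    rw [hν'eq]
    simp_rw [hk]
    exact ProbabilityMeasure.tendsto_map_of_tendsto_of_continuous _ _ hlim hcont
  · -- moments: `∫ e^{bu²} d(law ∘ (a·)⁻¹) = ∫ e^{b a² u²} d law ≤ C_{b a²}`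
    obtain ⟨C, hC⟩ := hmom (b * a ^ 2)
    refine ⟨C, fun k => ?_⟩
    rw [isingMagnetizationLaw_smul, integral_map (measurable_const_mul a).aemeasurable
      (by fun_prop : Continuous fun u : ℝ => Real.exp (b * u ^ 2)).aestronglyMeasurable]
    have : (fun u : ℝ => Real.exp (b * (a * u) ^ 2)) = fun u => Real.exp (b * a ^ 2 * u ^ 2) := by
      funext u; ring_nf
    rw [this]
    exact hC k

/-! ### The two-point laws -/

/-- **One spin of weight `a` has the symmetric two-point law** `½ δ_a + ½ δ_{−a}` (zero or any
coupling: the diagonal coupling of a single spin is immaterial). [Newman 1974, §1] [folklore] -/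
theorem integral_isingMagnetizationLaw_one (J : Fin 1 → Fin 1 → ℝ) (a : ℝ) (f : ℝ → ℝ)
    (hf : StronglyMeasurable f) :
    ∫ u, f u ∂(isingMagnetizationLaw 1 J (fun _ => a) : Measure ℝ) = (f a + f (-a)) / 2 := by
  rw [integral_isingMagnetizationLaw_eq_sum J _ hf]
  -- the two configurations of `Fin 1 → Bool`
  have huniv : (Finset.univ : Finset (Fin 1 → Bool)) = {fun _ => true, fun _ => false} := by
    ext s
    simp only [Finset.mem_univ, Finset.mem_insert, Finset.mem_singleton, true_iff]
    rcases Bool.eq_false_or_eq_true (s 0) with h0 | h0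
    · left; funext i; rw [Fin.fin_one_eq_zero i, h0]
    · right; funext i; rw [Fin.fin_one_eq_zero i, h0]
  have hne : (fun _ : Fin 1 => true) ≠ fun _ => false := fun h => by
    have := congrFun h 0; simp at this
  rw [huniv, Finset.sum_pair hne]
  -- Boltzmann weights: both equal `e^{J 0 0}`; magnetizations `±a`
  have hB : ∀ s : Fin 1 → Bool, isingBoltzmann J s = Real.exp (J 0 0) := by
    intro s
    simp only [isingBoltzmann, isingPairEnergy, Fin.sum_univ_one, spinVal]
    cases s 0 <;> simp
  have hZ : isingPairPartition J = 2 * Real.exp (J 0 0) := by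
    rw [isingPairPartition, huniv, Finset.sum_pair hne, hB, hB]; ring
  have hM1 : weightedMagnetization (fun _ : Fin 1 => a) (fun _ => true) = a := by
    simp [weightedMagnetization, spinVal]
  have hM2 : weightedMagnetization (fun _ : Fin 1 => a) (fun _ => false) = -a := by
    simp [weightedMagnetization, spinVal]
  rw [hB, hB, hZ, hM1, hM2, smul_eq_mul, smul_eq_mul]
  have hpos : Real.exp (J 0 0) ≠ 0 := (Real.exp_pos _).ne'
  field_simp

/-- The one-spin magnetization law is the two-point measure `½(δ_a + δ_{−a})`. [folklore] -/
theorem isingMagnetizationLaw_one_eq_twoPoint (J : Fin 1 → Fin 1 → ℝ) (a : ℝ) :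
    (isingMagnetizationLaw 1 J (fun _ => a) : Measure ℝ) =
      (2 : ℝ≥0∞)⁻¹ • (Measure.dirac a + Measure.dirac (-a)) := by
  haveI : IsProbabilityMeasure ((2 : ℝ≥0∞)⁻¹ • (Measure.dirac a + Measure.dirac (-a)) : Measure ℝ) := by
    refine ⟨?_⟩
    rw [Measure.smul_apply, Measure.add_apply, measure_univ, measure_univ, smul_eq_mul]
    rw [show (1 : ℝ≥0∞) + 1 = 2 by norm_num, ENNReal.inv_mul_cancel two_ne_zero ENNReal.ofNat_ne_top]
  refine Measure.ext_of_charFun (funext fun t => ?_)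
  rw [charFun_apply_real, charFun_apply_real, integral_smul_measure,
    integral_add_measure (integrable_dirac enorm_lt_top) (integrable_dirac enorm_lt_top),
    integral_dirac, integral_dirac, ENNReal.toReal_inv]
  -- left side: the finite law integrates the complex exponential to `(e^{ita} + e^{-ita})/2`
  have hre := integral_isingMagnetizationLaw_one J a (fun u => (Complex.exp (t * u * Complex.I)).re)
    (by fun_prop : Continuous _).stronglyMeasurable
  have him := integral_isingMagnetizationLaw_one J a (fun u => (Complex.exp (t * u * Complex.I)).im)
    (by fun_prop : Continuous _).stronglyMeasurable
  have hint : Integrable (fun u : ℝ => Complex.exp (t * u * Complex.I))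
      (isingMagnetizationLaw 1 J (fun _ => a) : Measure ℝ) :=
    integrable_isingMagnetizationLaw J _ (by fun_prop : Continuous _).stronglyMeasurable
  apply Complex.ext
  · rw [show (∫ u : ℝ, Complex.exp (t * u * Complex.I)
        ∂(isingMagnetizationLaw 1 J (fun _ => a) : Measure ℝ)).re =
        ∫ u : ℝ, (Complex.exp (t * u * Complex.I)).re
          ∂(isingMagnetizationLaw 1 J (fun _ => a) : Measure ℝ) from
      ((Complex.reCLM).integral_comp_comm hint).symm, hre]
    simp only [Complex.smul_re, Complex.add_re, ENNReal.toReal_ofNat, smul_eq_mul]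
    push_cast
    ring
  · rw [show (∫ u : ℝ, Complex.exp (t * u * Complex.I)
        ∂(isingMagnetizationLaw 1 J (fun _ => a) : Measure ℝ)).im =
        ∫ u : ℝ, (Complex.exp (t * u * Complex.I)).im
          ∂(isingMagnetizationLaw 1 J (fun _ => a) : Measure ℝ) from
      ((Complex.imCLM).integral_comp_comm hint).symm, him]
    simp only [Complex.smul_im, Complex.add_im, ENNReal.toReal_ofNat, smul_eq_mul]
    push_cast
    ring

/-- **The symmetric two-point laws are Ising limit laws** (one spin, no coupling).
[Newman 1974, §1] [folklore] -/
theorem isIsingLimitLaw_twoPoint {a : ℝ} (ha : 0 ≤ a) {ν : ProbabilityMeasure ℝ}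
    (h : (ν : Measure ℝ) = (2 : ℝ≥0∞)⁻¹ • (Measure.dirac a + Measure.dirac (-a))) :
    IsIsingLimitLaw ν := by
  have hν : ν = isingMagnetizationLaw 1 (fun _ _ => 0) (fun _ => a) := by
    apply ProbabilityMeasure.toMeasure_injective
    rw [h, isingMagnetizationLaw_one_eq_twoPoint]
  rw [hν]
  exact isIsingLimitLaw_isingMagnetizationLaw (fun _ _ => le_rfl) fun _ => ha

end Literature.Probability.LatticeModels

end
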